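import Mathlib.Analysis.MeanInequalities
import Mathlib.Analysis.Complex.Polynomial.Basic
import HarnessLib

/-!
# Szász's inequality for stable polynomials (Borcea–Brändén I, Lemma 5.3) and the coefficient bound

J. Borcea, P. Brändén, *The Lee–Yang and Pólya–Schur programs. I. Linear operators preserving stability*,
Invent. Math. 177 (2009) 541–569 (arXiv:0809.0401), §5.2 "Multivariate Szász principles":

> **Lemma 5.3 (Szász).** Suppose that `f(z) = 1 + Σ_{i=1}^k a_i z^i = Π_{j=1}^k (1 + ξ_j z)` is stable. Then
> `Σ_{j=1}^k |ξ_j|^2 ≤ 3|a_1|^2 + 2|a_2|`.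
>
> *Proof.* By assumption one has `Im(ξ_j) ≤ 0`, `1 ≤ j ≤ k`, hence `Σ_j Im(ξ_j)^2 ≤ (Σ_j Im(ξ_j))^2 = Im(a_1)^2`.
> Since `Σ_j ξ_j^2 = a_1^2 - 2a_2` it follows that
> `Σ_j |ξ_j|^2 = Σ_j (Re(ξ_j)^2 - Im(ξ_j)^2) + 2 Σ_j Im(ξ_j)^2 = Re(a_1^2 - 2a_2) + 2 Σ_j Im(ξ_j)^2
>  ≤ Re(a_1^2 - 2a_2) + 2 Im(a_1)^2 ≤ 3|a_1|^2 + 2|a_2|`, as claimed. □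
>
> Szász used his lemma to obtain the following bound for the polynomial `f` in Lemma 5.3:
> `|f(z)| ≤ exp(r|a_1| + 3r^2|a_1|^2 + 3r^2|a_2|)`, `|z| ≤ r`.

and, in the proof of Lemma 5.4 (p. 13): "If we rewrite `g(t) = Σ_{i=0}^k a_i t^i = Π_{j=1}^k (1 + ξ_j t)` then by
Lemma 5.3 we get `|a_k| = Π_j |ξ_j| ≤ [Σ_j |ξ_j|^2 / k]^{k/2} ≤ (3|a_1|^2 + 2|a_2|)^{k/2} k^{-k/2}`."

Here "stable" for a univariate `f ∈ ℂ[t]` means `f(t) ≠ 0` for `Im t > 0` (as in the rest of the topic). This file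
proves Lemma 5.3 for families `ξ : Fin k → ℂ` exactly along the printed lines (§1; the printed chain in fact gives
the sharper `Σ|ξ_j|^2 ≤ |a_1|^2 + 2|a_2|`, `szasz_sum_norm_sq_le_sharp`, since `Re(a_1^2) + 2 Im(a_1)^2 = |a_1|^2`),
identifies `a_1, a_2, a_k` as the coefficients of `Π_j (1 + ξ_j t)` (§2), shows that every `g ∈ ℂ[t]` with
`g(0) = 1` is such a product (§3, root extraction over `ℂ`), and derives the coefficient bound of the proof of
Lemma 5.4 by the inequality of arithmetic and geometric means (§4) and Szász's growth bound (§5).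

## Contents

* §1 `im_nonpos_of_prod_one_add_mul_ne_zero`, `sum_sq_le_sq_sum_of_nonpos`, **`szasz_sum_norm_sq_le_sharp`**,
  **`szasz_sum_norm_sq_le`** (Lemma 5.3 for families).
* §2 `oneAddProd ξ = Π_j (1 + ξ_j t)`: `eval_oneAddProd`, `oneAddProd_succ`, `coeff_zero_oneAddProd`,
  `coeff_one_oneAddProd`, `two_mul_coeff_two_oneAddProd`, `natDegree_oneAddProd_le`, `coeff_oneAddProd_last`.
* §3 **`exists_eq_oneAddProd`** (`g(0) = 1 ⇒ g = Π_j (1 + ξ_j t)` with `k = deg g`).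
* §4 `prod_le_arith_mean_pow` (AM–GM), **`szasz_polynomial`** (Lemma 5.3 for `g ∈ ℂ[t]` with `g(0) = 1`),
  **`norm_leadingCoeff_sq_le_of_stable`**, `norm_leadingCoeff_le_of_stable` (the bound used for Lemma 5.4).
* §5 **`szasz_norm_eval_le_exp`** (Szász's growth bound).

## References

* [BorceaBranden2009] J. Borcea, P. Brändén, Invent. Math. 177 (2009) 541–569, §5.2 Lemma 5.3, the display
  following it, and the proof of Lemma 5.4.
-/

noncomputable section

open Finset Polynomial

namespace Literature.Combinatorics.StablePolynomials

/-! ## §1 Lemma 5.3 for a family `ξ_1, …, ξ_k` -/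

section Family

variable {k : ℕ}

/-- **"By assumption one has `Im(ξ_j) ≤ 0`"**: if `Π_j (1 + ξ_j t) ≠ 0` for `Im t > 0` then every `Im ξ_j ≤ 0`
(otherwise `t = -1/ξ_j` lies in the upper half-plane and kills the `j`-th factor).
[cite: BorceaBranden2009, §5.2 proof of Lemma 5.3] -/
theorem im_nonpos_of_prod_one_add_mul_ne_zero (ξ : Fin k → ℂ)
    (hs : ∀ t : ℂ, 0 < t.im → ∏ j, (1 + ξ j * t) ≠ 0) (j : Fin k) : (ξ j).im ≤ 0 := by
  by_contra h
  have h' : 0 < (ξ j).im := not_le.1 h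
  have hξ : ξ j ≠ 0 := fun h0 => by
    rw [h0, Complex.zero_im] at h'
    exact lt_irrefl _ h'
  refine hs (-(ξ j)⁻¹) ?_ (prod_eq_zero (mem_univ j) ?_)
  · rw [Complex.neg_im, Complex.inv_im, neg_div, neg_neg]
    exact div_pos h' (Complex.normSq_pos.2 hξ)
  · rw [mul_neg, mul_inv_cancel₀ hξ, add_neg_cancel]

/-- **"`Σ_j Im(ξ_j)^2 ≤ (Σ_j Im(ξ_j))^2`"** for numbers of one sign (here `≤ 0`).
[cite: BorceaBranden2009, §5.2 proof of Lemma 5.3] -/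
theorem sum_sq_le_sq_sum_of_nonpos (y : Fin k → ℝ) (hy : ∀ j, y j ≤ 0) :
    ∑ j, y j ^ 2 ≤ (∑ j, y j) ^ 2 := by
  have hle : ∀ i, ∑ j, y j ≤ y i := fun i => by
    have h := single_le_sum (f := fun j => -y j) (fun j _ => neg_nonneg.2 (hy j)) (mem_univ i)
    rw [sum_neg_distrib] at h
    exact neg_le_neg_iff.1 h
  rw [sq, sum_mul]
  exact sum_le_sum fun i _ => by rw [sq]; exact mul_le_mul_of_nonpos_left (hle i) (hy i)

/-- **Szász's inequality, sharp form of the printed argument**: if `Π_j (1 + ξ_j t)` is stable then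
`Σ_j |ξ_j|^2 ≤ |a_1|^2 + |a_1^2 - Σ_j ξ_j^2| = |a_1|^2 + 2|a_2|`, where `a_1 = Σ_j ξ_j` and `2a_2 = a_1^2 - Σ_j ξ_j^2`
(the printed chain `Re(a_1^2 - 2a_2) + 2 Im(a_1)^2` equals `|a_1|^2 + Re(-2a_2)`).
[cite: BorceaBranden2009, §5.2 Lemma 5.3 (proof)] -/
theorem szasz_sum_norm_sq_le_sharp (ξ : Fin k → ℂ) (hs : ∀ t : ℂ, 0 < t.im → ∏ j, (1 + ξ j * t) ≠ 0) :
    ∑ j, ‖ξ j‖ ^ 2 ≤ ‖∑ j, ξ j‖ ^ 2 + ‖(∑ j, ξ j) ^ 2 - ∑ j, ξ j ^ 2‖ := by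
  have him : ∀ j, (ξ j).im ≤ 0 := im_nonpos_of_prod_one_add_mul_ne_zero ξ hs
  set a : ℂ := ∑ j, ξ j with ha_def
  set p₂ : ℂ := ∑ j, ξ j ^ 2 with hp_def
  -- `Σ |ξ_j|² = Re(Σ ξ_j²) + 2 Σ Im(ξ_j)²`
  have hnorm : ∀ j, ‖ξ j‖ ^ 2 = ((ξ j).re ^ 2 - (ξ j).im ^ 2) + 2 * (ξ j).im ^ 2 := fun j => by
    rw [Complex.sq_norm, Complex.normSq_apply]
    ring
  have hre : p₂.re = ∑ j, ((ξ j).re ^ 2 - (ξ j).im ^ 2) := by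
    rw [hp_def, Complex.re_sum]
    exact sum_congr rfl fun j _ => by rw [sq, Complex.mul_re]; ring
  have hsum : ∑ j, ‖ξ j‖ ^ 2 = p₂.re + 2 * ∑ j, (ξ j).im ^ 2 := by
    rw [hre, mul_sum, ← sum_add_distrib]
    exact sum_congr rfl fun j _ => hnorm j
  -- `Σ Im(ξ_j)² ≤ (Σ Im ξ_j)² = Im(a_1)²`
  have h1 : ∑ j, (ξ j).im ^ 2 ≤ a.im ^ 2 := by
    rw [ha_def, Complex.im_sum]
    exact sum_sq_le_sq_sum_of_nonpos _ him
  -- `Re(Σ ξ_j²) ≤ Re(a_1²) + |a_1² - Σ ξ_j²|`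
  have h2 : p₂.re ≤ (a ^ 2).re + ‖a ^ 2 - p₂‖ := by
    have h := (abs_le.1 (Complex.abs_re_le_norm (a ^ 2 - p₂))).1
    rw [Complex.sub_re] at h
    linarith
  -- `Re(a_1²) + 2 Im(a_1)² = |a_1|²`
  have h3 : (a ^ 2).re + 2 * a.im ^ 2 = ‖a‖ ^ 2 := by
    rw [sq, Complex.mul_re, Complex.sq_norm, Complex.normSq_apply]
    ring
  rw [hsum]
  linarith

/-- **Borcea–Brändén I, Lemma 5.3 (Szász)**, for a family: if `f(z) = Π_{j=1}^k (1 + ξ_j z)` is stable (no zeros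
in the open upper half-plane) and `a_1 = Σ_j ξ_j`, `a_2 = Σ_{i<j} ξ_i ξ_j` are its first two coefficients
(`2a_2 = a_1^2 - Σ_j ξ_j^2`), then `Σ_j |ξ_j|^2 ≤ 3|a_1|^2 + 2|a_2|`. Stated with `2|a_2| = |a_1^2 - Σ_j ξ_j^2|`.
[cite: BorceaBranden2009, §5.2 Lemma 5.3] -/
theorem szasz_sum_norm_sq_le (ξ : Fin k → ℂ) (hs : ∀ t : ℂ, 0 < t.im → ∏ j, (1 + ξ j * t) ≠ 0) :
    ∑ j, ‖ξ j‖ ^ 2 ≤ 3 * ‖∑ j, ξ j‖ ^ 2 + ‖(∑ j, ξ j) ^ 2 - ∑ j, ξ j ^ 2‖ := by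
  have h := szasz_sum_norm_sq_le_sharp ξ hs
  nlinarith [sq_nonneg ‖∑ j, ξ j‖]

end Family

/-! ## §2 The polynomial `Π_j (1 + ξ_j t)` and its coefficients -/

section OneAddProd

variable {k : ℕ}

/-- **`Π_{j=1}^k (1 + ξ_j t) ∈ ℂ[t]`.** [cite: BorceaBranden2009, §5.2 Lemma 5.3 ("`f(z) = 1 + Σ a_i z^i =
Π (1 + ξ_j z)`")] -/
def oneAddProd (ξ : Fin k → ℂ) : ℂ[X] :=
  ∏ j, (1 + C (ξ j) * X)

/-- `(Π_j (1 + ξ_j t))(t) = Π_j (1 + ξ_j t)`. [cite: BorceaBranden2009, §5.2 Lemma 5.3] -/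
theorem eval_oneAddProd (ξ : Fin k → ℂ) (t : ℂ) : (oneAddProd ξ).eval t = ∏ j, (1 + ξ j * t) := by
  rw [oneAddProd, eval_prod]
  simp only [eval_add, eval_one, eval_mul, eval_C, eval_X]

/-- Peeling off the first factor. [cite: BorceaBranden2009, §5.2 Lemma 5.3] -/
theorem oneAddProd_succ (ξ : Fin (k + 1) → ℂ) :
    oneAddProd ξ = (1 + C (ξ 0) * X) * oneAddProd fun i => ξ i.succ :=
  Fin.prod_univ_succ _

/-- Coefficients after multiplying by `1 + a t` (positive degrees). [folklore] -/
private theorem coeff_one_add_C_mul_X_mul_succ (a : ℂ) (p : ℂ[X]) (n : ℕ) :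
    ((1 + C a * X) * p).coeff (n + 1) = p.coeff (n + 1) + a * p.coeff n := by
  rw [add_mul, one_mul, coeff_add, mul_assoc, coeff_C_mul, coeff_X_mul]

/-- Constant coefficient after multiplying by `1 + a t`. [folklore] -/
private theorem coeff_one_add_C_mul_X_mul_zero (a : ℂ) (p : ℂ[X]) :
    ((1 + C a * X) * p).coeff 0 = p.coeff 0 := by
  rw [add_mul, one_mul, coeff_add, mul_assoc, coeff_C_mul, coeff_X_mul_zero, mul_zero, add_zero]

/-- `a_0 = 1`. [cite: BorceaBranden2009, §5.2 Lemma 5.3 ("`f(z) = 1 + Σ_{i≥1} a_i z^i`")] -/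
theorem coeff_zero_oneAddProd (ξ : Fin k → ℂ) : (oneAddProd ξ).coeff 0 = 1 := by
  induction k with
  | zero => rw [oneAddProd, Fin.prod_univ_zero, coeff_one_zero]
  | succ k ih => rw [oneAddProd_succ, coeff_one_add_C_mul_X_mul_zero, ih]

/-- **`a_1 = Σ_j ξ_j`.** [cite: BorceaBranden2009, §5.2 proof of Lemma 5.3 ("`Σ_j Im(ξ_j) = Im(a_1)`")] -/
theorem coeff_one_oneAddProd (ξ : Fin k → ℂ) : (oneAddProd ξ).coeff 1 = ∑ j, ξ j := by
  induction k with
  | zero => rw [oneAddProd, Fin.prod_univ_zero, Fin.sum_univ_zero, coeff_one, if_neg one_ne_zero]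
  | succ k ih =>
    rw [oneAddProd_succ, coeff_one_add_C_mul_X_mul_succ, ih, coeff_zero_oneAddProd, Fin.sum_univ_succ]
    ring

/-- **`2a_2 = a_1^2 - Σ_j ξ_j^2`** ("since `Σ_j ξ_j^2 = a_1^2 - 2a_2`"). [cite: BorceaBranden2009, §5.2 proof of
Lemma 5.3] -/
theorem two_mul_coeff_two_oneAddProd (ξ : Fin k → ℂ) :
    2 * (oneAddProd ξ).coeff 2 = (∑ j, ξ j) ^ 2 - ∑ j, ξ j ^ 2 := by
  induction k with
  | zero =>
    rw [oneAddProd, Fin.prod_univ_zero, Fin.sum_univ_zero, Fin.sum_univ_zero, coeff_one,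
      if_neg (by norm_num : (2 : ℕ) ≠ 0)]
    ring
  | succ k ih =>
    rw [oneAddProd_succ, coeff_one_add_C_mul_X_mul_succ, mul_add, ih, coeff_one_oneAddProd, Fin.sum_univ_succ,
      Fin.sum_univ_succ (f := fun j => ξ j ^ 2)]
    ring

/-- `deg Π_j (1 + ξ_j t) ≤ k`. [cite: BorceaBranden2009, §5.2 Lemma 5.3] -/
theorem natDegree_oneAddProd_le (ξ : Fin k → ℂ) : (oneAddProd ξ).natDegree ≤ k := by
  induction k with
  | zero => rw [oneAddProd, Fin.prod_univ_zero, natDegree_one]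
  | succ k ih =>
    rw [oneAddProd_succ]
    refine (natDegree_mul_le).trans ?_
    have h1 : (1 + C (ξ 0) * X : ℂ[X]).natDegree ≤ 1 :=
      (natDegree_add_le _ _).trans (max_le (by rw [natDegree_one]; exact Nat.zero_le _)
        ((natDegree_C_mul_le _ _).trans natDegree_X_le))
    have h2 := ih (fun i => ξ i.succ)
    omega

/-- **`a_k = Π_j ξ_j`** (the top coefficient). [cite: BorceaBranden2009, §5.2 proof of Lemma 5.4 ("`|a_k| =
Π_j |ξ_j|`")] -/
theorem coeff_oneAddProd_last (ξ : Fin k → ℂ) : (oneAddProd ξ).coeff k = ∏ j, ξ j := by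
  induction k with
  | zero => rw [oneAddProd, Fin.prod_univ_zero, Fin.prod_univ_zero, coeff_one_zero]
  | succ k ih =>
    rw [oneAddProd_succ, coeff_one_add_C_mul_X_mul_succ, ih, Fin.prod_univ_succ,
      coeff_eq_zero_of_natDegree_lt (Nat.lt_succ_of_le (natDegree_oneAddProd_le _)), zero_add]

/-- Stability of `Π_j (1 + ξ_j t)` in terms of the family. [cite: BorceaBranden2009, §5.2 Lemma 5.3] -/
theorem oneAddProd_stable_iff (ξ : Fin k → ℂ) :
    (∀ t : ℂ, 0 < t.im → (oneAddProd ξ).eval t ≠ 0) ↔ ∀ t : ℂ, 0 < t.im → ∏ j, (1 + ξ j * t) ≠ 0 := by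
  simp only [eval_oneAddProd]

end OneAddProd

/-! ## §3 Every `g` with `g(0) = 1` is `Π_j (1 + ξ_j t)` -/

section Factor

/-- One root extraction: `(X - r) q = (1 - t/r) · (-r q)` for `r ≠ 0`. [folklore] -/
private theorem X_sub_C_mul_eq {r : ℂ} (hr : r ≠ 0) (q : ℂ[X]) :
    (X - C r) * q = (1 + C (-r⁻¹) * X) * (C (-r) * q) := by
  have h1 : C r⁻¹ * C r = (1 : ℂ[X]) := by rw [← C_mul, inv_mul_cancel₀ hr, C_1]
  rw [C_neg, C_neg]
  linear_combination (-(X * q)) * h1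

/-- **Every `g ∈ ℂ[t]` with `g(0) = 1` factors as `g(t) = Π_{j=1}^{deg g} (1 + ξ_j t)`** (`ξ_j = -1/r_j` over the
roots `r_j`; `ℂ` is algebraically closed). [cite: BorceaBranden2009, §5.2 Lemma 5.3 ("`f(z) = 1 + Σ_{i=1}^k a_i z^i
= Π_{j=1}^k (1 + ξ_j z)`")] -/
theorem exists_eq_oneAddProd (g : ℂ[X]) (h0 : g.coeff 0 = 1) :
    ∃ (k : ℕ) (ξ : Fin k → ℂ), g.natDegree = k ∧ g = oneAddProd ξ := by
  suffices H : ∀ (n : ℕ) (g : ℂ[X]), g.natDegree = n → g.coeff 0 = 1 → ∃ ξ : Fin n → ℂ, g = oneAddProd ξ by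
    obtain ⟨ξ, hξ⟩ := H _ g rfl h0
    exact ⟨_, ξ, rfl, hξ⟩
  intro n
  induction n with
  | zero =>
    intro g hn h0
    refine ⟨fun i => i.elim0, ?_⟩
    rw [oneAddProd, Fin.prod_univ_zero, eq_C_of_natDegree_eq_zero hn, h0, C_1]
  | succ n ih =>
    intro g hn h0
    have hg0 : g ≠ 0 := fun h => by
      rw [h, coeff_zero] at h0
      exact zero_ne_one h0
    have hdeg : 0 < degree g := natDegree_pos_iff_degree_pos.1 (by omega)
    obtain ⟨r, hr⟩ := Complex.exists_root hdeg
    have hr0 : r ≠ 0 := by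
      rintro rfl
      rw [IsRoot, ← coeff_zero_eq_eval_zero, h0] at hr
      exact one_ne_zero hr
    set q := g /ₘ (X - C r) with hq_def
    have hq : (X - C r) * q = g := mul_divByMonic_eq_iff_isRoot.2 hr
    have hq0 : q ≠ 0 := fun h => hg0 (by rw [← hq, h, mul_zero])
    have hfac : g = (1 + C (-r⁻¹) * X) * (C (-r) * q) := by rw [← hq, X_sub_C_mul_eq hr0]
    -- the cofactor `q' = -r q` has `q'(0) = 1` and degree `n`
    have hq'0 : (C (-r) * q).coeff 0 = 1 := by rw [← coeff_one_add_C_mul_X_mul_zero (-r⁻¹), ← hfac, h0]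
    have hq'deg : (C (-r) * q).natDegree = n := by
      have h1 : g.natDegree = 1 + q.natDegree := by
        rw [← hq, natDegree_mul (X_sub_C_ne_zero r) hq0, natDegree_X_sub_C]
      rw [natDegree_C_mul (neg_ne_zero.2 hr0)]
      omega
    obtain ⟨ξ', hξ'⟩ := ih _ hq'deg hq'0
    refine ⟨Fin.cons (-r⁻¹) ξ', ?_⟩
    rw [oneAddProd_succ]
    simp only [Fin.cons_zero, Fin.cons_succ]
    rw [← hξ']
    exact hfac

end Factor

/-! ## §4 The inequality of the means and the coefficient bound -/

section Bound

/-- **AM–GM with natural exponents**: `Π_i z_i ≤ ((Σ_i z_i)/k)^k` for `z_i ≥ 0`.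
[cite: BorceaBranden2009, §5.2 proof of Lemma 5.4 ("`Π_j |ξ_j| ≤ [Σ_j |ξ_j|^2 / k]^{k/2}`")] -/
theorem prod_le_arith_mean_pow {k : ℕ} (z : Fin k → ℝ) (hz : ∀ i, 0 ≤ z i) :
    ∏ i, z i ≤ ((∑ i, z i) / k) ^ k := by
  rcases Nat.eq_zero_or_pos k with rfl | hk
  · simp
  have hk' : (0 : ℝ) < k := Nat.cast_pos.2 hk
  have h := Real.geom_mean_le_arith_mean_weighted (univ : Finset (Fin k)) (fun _ => (k : ℝ)⁻¹) z
    (fun _ _ => inv_nonneg.2 hk'.le)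
    (by rw [sum_const, card_univ, Fintype.card_fin, nsmul_eq_mul, mul_inv_cancel₀ hk'.ne']) (fun i _ => hz i)
  rw [← mul_sum, Real.finsetProd_rpow _ _ (fun i _ => hz i)] at h
  have hP : 0 ≤ ∏ i, z i := prod_nonneg fun i _ => hz i
  have h2 := pow_le_pow_left₀ (Real.rpow_nonneg hP _) h k
  rw [← Real.rpow_natCast ((∏ i, z i) ^ ((k : ℝ)⁻¹)), ← Real.rpow_mul hP, inv_mul_cancel₀ hk'.ne', Real.rpow_one,
    inv_mul_eq_div] at h2
  exact h2

/-- **Borcea–Brändén I, Lemma 5.3 (Szász), polynomial form.** If `g ∈ ℂ[t]` with `g(0) = 1` is stable then,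
writing `g(t) = Π_{j=1}^k (1 + ξ_j t)` (`k = deg g`), `Σ_j |ξ_j|^2 ≤ 3|a_1|^2 + 2|a_2|` with `a_i` the coefficients
of `g`. [cite: BorceaBranden2009, §5.2 Lemma 5.3] -/
theorem szasz_polynomial {g : ℂ[X]} (h0 : g.coeff 0 = 1) (hs : ∀ t : ℂ, 0 < t.im → g.eval t ≠ 0) :
    ∃ (k : ℕ) (ξ : Fin k → ℂ), g.natDegree = k ∧ g = oneAddProd ξ ∧
      ∑ j, ‖ξ j‖ ^ 2 ≤ 3 * ‖g.coeff 1‖ ^ 2 + 2 * ‖g.coeff 2‖ := by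
  obtain ⟨k, ξ, hk, hξ⟩ := exists_eq_oneAddProd g h0
  refine ⟨k, ξ, hk, hξ, ?_⟩
  have hs' : ∀ t : ℂ, 0 < t.im → ∏ j, (1 + ξ j * t) ≠ 0 := fun t ht => by
    rw [← eval_oneAddProd, ← hξ]
    exact hs t ht
  have h := szasz_sum_norm_sq_le ξ hs'
  have h2 : ‖(∑ j, ξ j) ^ 2 - ∑ j, ξ j ^ 2‖ = 2 * ‖g.coeff 2‖ := by
    rw [hξ, ← two_mul_coeff_two_oneAddProd, norm_mul, Complex.norm_two]
  rwa [h2, ← coeff_one_oneAddProd, ← hξ] at h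

/-- **The coefficient bound of the proof of Lemma 5.4** ("`|a_k| = Π_j|ξ_j| ≤ [Σ_j|ξ_j|^2/k]^{k/2} ≤
(3|a_1|^2 + 2|a_2|)^{k/2} k^{-k/2}`"), squared: for a stable `g ∈ ℂ[t]` with `g(0) = 1` and `k = deg g`,
`|a_k|^2 ≤ ((3|a_1|^2 + 2|a_2|)/k)^k`. [cite: BorceaBranden2009, §5.2 proof of Lemma 5.4] -/
theorem norm_leadingCoeff_sq_le_of_stable {g : ℂ[X]} (h0 : g.coeff 0 = 1)
    (hs : ∀ t : ℂ, 0 < t.im → g.eval t ≠ 0) :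
    ‖g.leadingCoeff‖ ^ 2 ≤ ((3 * ‖g.coeff 1‖ ^ 2 + 2 * ‖g.coeff 2‖) / g.natDegree) ^ g.natDegree := by
  obtain ⟨k, ξ, hk, hξ, hsz⟩ := szasz_polynomial h0 hs
  have hlead : g.leadingCoeff = ∏ j, ξ j := by
    rw [leadingCoeff, hk, hξ]
    exact coeff_oneAddProd_last ξ
  rw [hk, hlead, norm_prod, ← prod_pow]
  refine (prod_le_arith_mean_pow (fun j => ‖ξ j‖ ^ 2) fun j => sq_nonneg _).trans ?_
  rcases Nat.eq_zero_or_pos k with hk0 | hk0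
  · -- no factors
    subst hk0
    rw [pow_zero, pow_zero]
  · exact pow_le_pow_left₀ (div_nonneg (sum_nonneg fun j _ => sq_nonneg _) (Nat.cast_nonneg _))
      (div_le_div_of_nonneg_right hsz (Nat.cast_nonneg _)) _

/-- The same bound, unsquared: `|a_k| ≤ (√((3|a_1|^2 + 2|a_2|)/k))^k = (3|a_1|^2+2|a_2|)^{k/2} k^{-k/2}`.
[cite: BorceaBranden2009, §5.2 proof of Lemma 5.4] -/
theorem norm_leadingCoeff_le_of_stable {g : ℂ[X]} (h0 : g.coeff 0 = 1)
    (hs : ∀ t : ℂ, 0 < t.im → g.eval t ≠ 0) :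
    ‖g.leadingCoeff‖ ≤ (Real.sqrt ((3 * ‖g.coeff 1‖ ^ 2 + 2 * ‖g.coeff 2‖) / g.natDegree)) ^ g.natDegree := by
  have h := norm_leadingCoeff_sq_le_of_stable h0 hs
  have hB : 0 ≤ (3 * ‖g.coeff 1‖ ^ 2 + 2 * ‖g.coeff 2‖) / g.natDegree :=
    div_nonneg (by positivity) (Nat.cast_nonneg _)
  have h2 : ((3 * ‖g.coeff 1‖ ^ 2 + 2 * ‖g.coeff 2‖) / g.natDegree) ^ g.natDegree =
      ((Real.sqrt ((3 * ‖g.coeff 1‖ ^ 2 + 2 * ‖g.coeff 2‖) / g.natDegree)) ^ g.natDegree) ^ 2 := by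
    rw [← pow_mul, pow_mul', Real.sq_sqrt hB]
  rw [h2] at h
  have h3 := Real.sqrt_le_sqrt h
  rwa [Real.sqrt_sq (norm_nonneg _), Real.sqrt_sq (pow_nonneg (Real.sqrt_nonneg _) _)] at h3

end Bound

/-! ## §5 Szász's growth bound -/

section Growth

/-- `|1 + w|^2 ≤ exp(2 Re w + |w|^2)` (`1 + x ≤ e^x`). [folklore] -/
private theorem norm_one_add_sq_le_exp (w : ℂ) : ‖1 + w‖ ^ 2 ≤ Real.exp (2 * w.re + ‖w‖ ^ 2) := by
  have h : ‖1 + w‖ ^ 2 = (2 * w.re + ‖w‖ ^ 2) + 1 := by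
    rw [Complex.sq_norm, Complex.sq_norm, Complex.normSq_apply, Complex.normSq_apply, Complex.add_re,
      Complex.add_im, Complex.one_re, Complex.one_im]
    ring
  rw [h]
  exact Real.add_one_le_exp _

/-- **Szász's growth bound** ("Szász used his lemma to obtain the following bound for the polynomial `f` in
Lemma 5.3"): if `g ∈ ℂ[t]` with `g(0) = 1` is stable then `|g(z)| ≤ exp(r|a_1| + 3r^2|a_1|^2 + 3r^2|a_2|)` for
`|z| ≤ r` (from `|1 + ξ_j z|^2 ≤ exp(2Re(ξ_j z) + |ξ_j|^2 r^2)`, `Σ_j Re(ξ_j z) = Re(a_1 z)` and Lemma 5.3; the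
argument gives the slightly smaller exponent `r|a_1| + (3/2) r^2 |a_1|^2 + r^2 |a_2|`).
[cite: BorceaBranden2009, §5.2 (display after Lemma 5.3)] -/
theorem szasz_norm_eval_le_exp {g : ℂ[X]} (h0 : g.coeff 0 = 1) (hs : ∀ t : ℂ, 0 < t.im → g.eval t ≠ 0)
    {r : ℝ} {z : ℂ} (hz : ‖z‖ ≤ r) :
    ‖g.eval z‖ ≤ Real.exp (r * ‖g.coeff 1‖ + 3 * r ^ 2 * ‖g.coeff 1‖ ^ 2 + 3 * r ^ 2 * ‖g.coeff 2‖) := by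
  obtain ⟨k, ξ, hk, hξ, hsz⟩ := szasz_polynomial h0 hs
  have hr : 0 ≤ r := (norm_nonneg z).trans hz
  have ha1 : g.coeff 1 = ∑ j, ξ j := by rw [hξ, coeff_one_oneAddProd]
  -- `|g(z)|² ≤ exp(Σ_j (2 Re(ξ_j z) + |ξ_j z|²))`
  have h1 : ‖g.eval z‖ ^ 2 ≤ Real.exp (∑ j, (2 * (ξ j * z).re + ‖ξ j * z‖ ^ 2)) := by
    rw [hξ, eval_oneAddProd, norm_prod, ← prod_pow, Real.exp_sum]
    exact prod_le_prod (fun j _ => sq_nonneg _) fun j _ => norm_one_add_sq_le_exp _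
  -- the exponent is `2 Re(a_1 z) + |z|² Σ|ξ_j|² ≤ 2 r |a_1| + r² (3|a_1|² + 2|a_2|)`
  have h2 : ∑ j, (2 * (ξ j * z).re + ‖ξ j * z‖ ^ 2) = 2 * (g.coeff 1 * z).re + ‖z‖ ^ 2 * ∑ j, ‖ξ j‖ ^ 2 := by
    rw [ha1, sum_mul, Complex.re_sum, mul_sum, mul_sum, ← sum_add_distrib]
    exact sum_congr rfl fun j _ => by rw [norm_mul, mul_pow]; ring
  have h3 : 2 * (g.coeff 1 * z).re ≤ 2 * (r * ‖g.coeff 1‖) := by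
    have := (abs_le.1 (Complex.abs_re_le_norm (g.coeff 1 * z))).2
    rw [norm_mul] at this
    nlinarith [norm_nonneg (g.coeff 1), norm_nonneg z]
  have h4 : ‖z‖ ^ 2 * ∑ j, ‖ξ j‖ ^ 2 ≤ r ^ 2 * (3 * ‖g.coeff 1‖ ^ 2 + 2 * ‖g.coeff 2‖) :=
    mul_le_mul (pow_le_pow_left₀ (norm_nonneg z) hz 2) hsz (sum_nonneg fun j _ => sq_nonneg _) (sq_nonneg r)
  have h5 : ‖g.eval z‖ ^ 2 ≤
      Real.exp (r * ‖g.coeff 1‖ + 3 * r ^ 2 * ‖g.coeff 1‖ ^ 2 + 3 * r ^ 2 * ‖g.coeff 2‖) ^ 2 := by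
    rw [← Real.exp_nat_mul, Nat.cast_ofNat]
    refine h1.trans (Real.exp_le_exp.2 ?_)
    rw [h2]
    nlinarith [h3, h4, mul_nonneg (sq_nonneg r) (sq_nonneg ‖g.coeff 1‖),
      mul_nonneg (sq_nonneg r) (norm_nonneg (g.coeff 2))]
  exact (pow_le_pow_iff_left₀ (norm_nonneg _) (Real.exp_nonneg _) two_ne_zero).1 h5

end Growth

end Literature.Combinatorics.StablePolynomials

end
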